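import Summits.NavierStokesRegularity.FluidComputer.SmoothedHillVortexPotential
import Summits.NavierStokesRegularity.FluidComputer.SmoothedHillVortexCalculus
import HarnessLib

/-!
# The smoothed Hill spherical vortex, IV: the field — smooth, divergence free, axisymmetric,
# swirl free, single-signed `ω_θ / r`, speed envelope, Hill core

Cell `ns-blowup`, seat `ns-blowup-fc-prover-3` (g6); sequel of `SmoothedHillVortexProfile` (I),
`…Potential` (II), `…Calculus` (III). LABEL: kinematics (definitions with bodies + proved lemmas; no
named fact; nothing about Navier–Stokes dynamics is asserted). WHAT THIS IS NOT: not NS evidence — an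
explicit smooth vector field, used by the cell as the LAZY ENVELOPE SLICE of the negative lane of crux
`HeredityAtOne` (stmt-NavierStokesRegularity-19249; census §Strengthen (e), S⁺).

`hillField M a b = profileField (slope M a b) (potential M a b)`: the smoothed Hill spherical vortex
with vorticity quotient level `M`, core radius `a`, outer radius `b` (`0 < a < b`, `0 ≤ M`):

* `contDiff_hillField` (`C^∞`), `isDivFree_hillField`, `hasNoSwirl_hillField`,
  `isAxisymmetric_hillField`;
* `curl_hillField`: `curl u = η₁(|x|²) • (−x₁, x₀, 0)`; **`angVortQuot_hillField`**:
  `ω_θ / r = η₁(|x|²) = M φ(|x|²)` everywhere — hence `0 ≤ ω_θ/r ≤ M`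
  (`angVortQuot_hillField_nonneg/_le`), `= M` on the core, `= 0` off the ball of radius `b`;
* **`norm_hillField_le`**: `‖u(x)‖ ≤ M b²/3` everywhere (the speed envelope of II);
* the HILL CORE: `hillField_of_core` (`u = ((M/5) x₀x₂, (M/5) x₁x₂, 2g(0) − (M/5)(2x₀²+2x₁²+x₂²))`
  on `|x|² ≤ a²` — Acheson (5.25) / tree `hillCoreU/V/W` with `c = M`, plus the constant drift
  `2g(0) − M a²/…`), `hillField_zero`, `norm_hillField_zero` (`= 2 g(0) ∈ [M a²/3, M b²/3]`),
  `fderiv_hillField_core_single_zero` (`∂₀u = ((M/5)x₂, 0, −(4M/5)x₀)` on the open core) and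
  `norm_fderiv_hillField_ge` (`‖Du(x)‖ ≥ (4M/5) x₀` there, `x₀ ≥ 0`).

References: M. J. M. Hill, Phil. Trans. R. Soc. London A 185 (1894) 213–245 [cite: Hill1894, Art. 1–4];
D. J. Acheson, *Elementary Fluid Dynamics* (OUP 1990) §5.5 [cite: Acheson1990, §5.5, eqs. (5.15)–(5.25)].
-/

noncomputable section

open Real Set Function
open scoped ContDiff

namespace Summit.NavierStokesRegularity.FluidComputer

namespace SmoothedHill

open Literature.Analysis.FluidPDE

local notation "ℝ³" => EuclideanSpace ℝ (Fin 3)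

variable {M a b : ℝ}

/-- **The smoothed Hill spherical vortex** with vorticity-quotient level `M`, core radius `a` and
outer radius `b`: the profile field of `(g', g) = (slope, potential)`.
[cite: Acheson1990, §5.5, eq. (5.25)] -/
def hillField (M a b : ℝ) : ℝ³ → ℝ³ := profileField (slope M a b) (potential M a b)

/-- `g'` has derivative `g'' = deriv g'` everywhere. [folklore] -/
theorem hasDerivAt_slope (M a b s : ℝ) :
    HasDerivAt (slope M a b) (deriv (slope M a b) s) s :=
  (((contDiff_slope M a b (n := 1)).differentiable (by simp)) s).hasDerivAt

/-- `g''` is continuous. [folklore] -/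
theorem continuous_deriv_slope (M a b : ℝ) : Continuous (deriv (slope M a b)) :=
  (contDiff_slope M a b (n := 1)).continuous_deriv (by simp)

/-- The smoothed Hill vortex is `C^∞`. [folklore] -/
theorem contDiff_hillField (M a b : ℝ) {n : ℕ∞} : ContDiff ℝ n (hillField M a b) :=
  contDiff_profileField _ _ (contDiff_slope M a b) (contDiff_potential M a b)

/-- The smoothed Hill vortex is continuous. [folklore] -/
theorem continuous_hillField (M a b : ℝ) : Continuous (hillField M a b) :=
  (contDiff_hillField M a b (n := 0)).continuous

/-- The smoothed Hill vortex is differentiable. [folklore] -/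
theorem differentiable_hillField (M a b : ℝ) : Differentiable ℝ (hillField M a b) :=
  differentiable_profileField (hasDerivAt_slope M a b) (hasDerivAt_potential M a b)

/-- **Divergence free.** [cite: Acheson1990, §5.5, eq. (5.25)] -/
theorem isDivFree_hillField (M a b : ℝ) : VectorCalculus.IsDivFree (hillField M a b) :=
  isDivFree_profileField (hasDerivAt_slope M a b) (hasDerivAt_potential M a b)

/-- **No swirl.** [cite: Acheson1990, §5.5, eq. (5.15)] -/
theorem hasNoSwirl_hillField (M a b : ℝ) : HasNoSwirl (hillField M a b) :=
  hasNoSwirl_profileField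

/-- **Axisymmetric.** [cite: Acheson1990, §5.5, eq. (5.15)] -/
theorem isAxisymmetric_hillField (M a b : ℝ) : IsAxisymmetric (hillField M a b) :=
  isAxisymmetric_profileField

/-- The Jacobian entries of the smoothed Hill vortex. [folklore] -/
theorem fderiv_hillField_single (M a b : ℝ) (x : ℝ³) (j i : Fin 3) :
    fderiv ℝ (hillField M a b) x (EuclideanSpace.single j (1 : ℝ)) i =
      jac (slope M a b) (deriv (slope M a b)) x j i :=
  fderiv_profileField_single (hasDerivAt_slope M a b) (hasDerivAt_potential M a b) x j i

/-- **The vorticity**: `curl u (x) = η₁(|x|²) • (−x₁, x₀, 0)` (`0 < a < b`).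
[cite: Acheson1990, §5.5, eqs. (5.16) and (5.25)] -/
theorem curl_hillField (ha : 0 < a) (hab : a < b) (x : ℝ³) :
    curl (hillField M a b) x = quot M a b (rsq x) • rotGen x := by
  rw [hillField, curl_profileField (hasDerivAt_slope M a b) (hasDerivAt_potential M a b), quotOf,
    quot_eq_slope_deriv ha hab]

/-- **`ω_θ / r = η₁(|x|²)` everywhere** (`0 < a < b`). [cite: Acheson1990, §5.5, eq. (5.16)] -/
theorem angVortQuot_hillField (ha : 0 < a) (hab : a < b) (x : ℝ³) :
    angVortQuot (hillField M a b) x = quot M a b (rsq x) := by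
  rw [hillField, angVortQuot_profileField (contDiff_slope M a b) (contDiff_potential M a b)
    (hasDerivAt_slope M a b) (hasDerivAt_potential M a b) (continuous_deriv_slope M a b), quotOf,
    quot_eq_slope_deriv ha hab]

/-- `0 ≤ ω_θ / r` (single-signed vorticity quotient; `0 ≤ M`, `0 < a < b`). [folklore] -/
theorem angVortQuot_hillField_nonneg (hM : 0 ≤ M) (ha : 0 < a) (hab : a < b) (x : ℝ³) :
    0 ≤ angVortQuot (hillField M a b) x := by
  rw [angVortQuot_hillField ha hab]; exact quot_nonneg hM _ _ _

/-- `ω_θ / r ≤ M` (`0 ≤ M`, `0 < a < b`). [folklore] -/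
theorem angVortQuot_hillField_le (hM : 0 ≤ M) (ha : 0 < a) (hab : a < b) (x : ℝ³) :
    angVortQuot (hillField M a b) x ≤ M := by
  rw [angVortQuot_hillField ha hab]; exact quot_le hM _ _ _

/-- `ω_θ / r = M` on the core `|x|² ≤ a²`. [cite: Acheson1990, §5.5, eq. (5.25)] -/
theorem angVortQuot_hillField_of_core (ha : 0 < a) (hab : a < b) {x : ℝ³} (hx : rsq x ≤ a ^ 2) :
    angVortQuot (hillField M a b) x = M := by
  rw [angVortQuot_hillField ha hab, quot_of_le ha.le hab hx]

/-- `ω_θ / r = 0` off the ball `|x|² ≥ b²`. [folklore] -/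
theorem angVortQuot_hillField_of_ge (ha : 0 < a) (hab : a < b) {x : ℝ³} (hx : b ^ 2 ≤ rsq x) :
    angVortQuot (hillField M a b) x = 0 := by
  rw [angVortQuot_hillField ha hab, quot_of_ge ha.le hab hx]

/-! ## The speed envelope -/

/-- **`‖u(x)‖ ≤ M b²/3` everywhere** (`0 ≤ M`, `0 < a < b`): `‖u‖² ≤ 4g'² |x|⁴ + 4g²` (the cross
term `8 g g' (x₀²+x₁²)` is nonpositive) and the speed envelope of II. [folklore] -/
theorem norm_hillField_le (hM : 0 ≤ M) (ha : 0 < a) (hab : a < b) (x : ℝ³) :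
    ‖hillField M a b x‖ ≤ M * b ^ 2 / 3 := by
  have hb : 0 < b := ha.trans hab
  have hs := rsq_nonneg x
  have hq0 : 0 ≤ x 0 ^ 2 + x 1 ^ 2 := by positivity
  have hq := cyl_sq_le_rsq x
  have h4 := four_sq_add_le hM ha hab hs
  have hg := potential_nonneg hM ha.le hab (rsq x)
  have hsl := (slope_mem hM a b (rsq x)).2
  have hsq : ‖hillField M a b x‖ ^ 2 ≤ (M * b ^ 2 / 3) ^ 2 := by
    rw [hillField, norm_sq_profileField]
    set S := slope M a b (rsq x)
    set P := potential M a b (rsq x)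
    set q := x 0 ^ 2 + x 1 ^ 2
    have hrs : rsq x = q + x 2 ^ 2 := rfl
    have hcross : P * S * q ≤ 0 :=
      mul_nonpos_of_nonpos_of_nonneg (mul_nonpos_of_nonneg_of_nonpos hg hsl) hq0
    have hS2 : 0 ≤ S ^ 2 := sq_nonneg _
    have hmono : S ^ 2 * q * rsq x ≤ S ^ 2 * rsq x ^ 2 := by
      rw [sq (rsq x), ← mul_assoc]
      exact mul_le_mul_of_nonneg_right (mul_le_mul_of_nonneg_left hq hS2) hs
    calc 4 * S ^ 2 * x 2 ^ 2 * q + (2 * P + 2 * S * q) ^ 2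
        = 4 * P ^ 2 + 4 * (S ^ 2 * q * rsq x) + 8 * (P * S * q) := by rw [hrs]; ring
      _ ≤ 4 * P ^ 2 + 4 * (S ^ 2 * rsq x ^ 2) + 0 := by linarith
      _ = 4 * P ^ 2 + 4 * S ^ 2 * rsq x ^ 2 := by ring
      _ ≤ (M * b ^ 2 / 3) ^ 2 := h4
  exact (pow_le_pow_iff_left₀ (norm_nonneg _) (by positivity) two_ne_zero).1 hsq

/-! ## The Hill core and the dipole tail in closed form -/

/-- **The Hill core**: on `|x|² ≤ a²` the smoothed Hill vortex IS Hill's rotational core (with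
`ω_θ/r = M`) translated by the constant axial drift `2g(0)`:
`u(x) = ((M/5) x₀x₂, (M/5) x₁x₂, 2g(0) − (M/5)(2x₀² + 2x₁² + x₂²))` (Acheson (5.25) / tree
`hillCoreU/V/W` with `c = M`, lab frame). [cite: Acheson1990, §5.5, eq. (5.25)] -/
theorem hillField_of_core (ha : 0 < a) (hab : a < b) {x : ℝ³} (hx : rsq x ≤ a ^ 2) :
    hillField M a b x = !₂[M / 5 * x 0 * x 2, M / 5 * x 1 * x 2,
      2 * potential M a b 0 - M / 5 * (2 * x 0 ^ 2 + 2 * x 1 ^ 2 + x 2 ^ 2)] := by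
  have hS := slope_of_le (M := M) ha.le hab hx
  have hP := potential_of_le (M := M) ha.le hab hx
  ext i
  fin_cases i
  · show hillField M a b x 0 = M / 5 * x 0 * x 2
    rw [hillField, profileField_apply_zero, hS]
    ring
  · show hillField M a b x 1 = M / 5 * x 1 * x 2
    rw [hillField, profileField_apply_one, hS]
    ring
  · show hillField M a b x 2 = 2 * potential M a b 0 - M / 5 * (2 * x 0 ^ 2 + 2 * x 1 ^ 2 + x 2 ^ 2)
    rw [hillField, profileField_apply_two, hS, hP, rsq]
    ring

/-- The value at the centre: `u(0) = (0, 0, 2 g(0))`. [cite: Acheson1990, §5.5, eq. (5.25)] -/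
theorem hillField_zero (M a b : ℝ) : hillField M a b 0 = !₂[0, 0, 2 * potential M a b 0] := by
  ext i
  fin_cases i <;> simp [hillField, rsq]

/-- The centre speed is `2 g(0)` (`0 ≤ M`, `0 ≤ a < b`). [folklore] -/
theorem norm_hillField_zero (hM : 0 ≤ M) (ha : 0 ≤ a) (hab : a < b) :
    ‖hillField M a b 0‖ = 2 * potential M a b 0 := by
  have hg := potential_nonneg hM ha hab 0
  rw [hillField_zero, EuclideanSpace.norm_eq, Fin.sum_univ_three]
  simp only [Matrix.cons_val_zero, Matrix.cons_val_one, Matrix.cons_val_two,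
    Matrix.tail_cons, Matrix.head_cons, norm_zero, Real.norm_eq_abs]
  rw [abs_of_nonneg (by positivity), show (0:ℝ) ^ 2 + 0 ^ 2 + (2 * potential M a b 0) ^ 2 =
    (2 * potential M a b 0) ^ 2 by ring, Real.sqrt_sq (by positivity)]

/-- **The centre speed is at least the Hill centre speed of the core**: `M a²/3 ≤ ‖u(0)‖`
(`0 ≤ M`, `0 < a < b`). [folklore] -/
theorem le_norm_hillField_zero (hM : 0 ≤ M) (ha : 0 < a) (hab : a < b) :
    M * a ^ 2 / 3 ≤ ‖hillField M a b 0‖ := by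
  rw [norm_hillField_zero hM ha.le hab]
  have := le_potential_zero hM ha hab
  linarith

/-- On the OPEN core `|x|² < a²`: `∂₀ u (x) = ((M/5) x₂, 0, −(4M/5) x₀)` (`g'' = 0`, `g' = −M/10`
there). [cite: Acheson1990, §5.5, eq. (5.25)] -/
theorem fderiv_hillField_core_zero (ha : 0 < a) (hab : a < b) {x : ℝ³} (hx : rsq x < a ^ 2) :
    fderiv ℝ (hillField M a b) x (EuclideanSpace.single 0 (1 : ℝ)) =
      !₂[M / 5 * x 2, 0, -(4 * M / 5) * x 0] := by
  have hS := slope_of_le (M := M) ha.le hab hx.le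
  have hS' := deriv_slope_of_lt (M := M) ha.le hab hx
  ext i
  rw [fderiv_hillField_single]
  fin_cases i
  · show jac _ _ x 0 0 = M / 5 * x 2
    simp only [jac, Matrix.cons_val_zero]
    rw [hS, hS']
    ring
  · show jac _ _ x 0 1 = 0
    simp only [jac, Matrix.cons_val_zero, Matrix.cons_val_one]
    rw [hS']
    ring
  · show jac _ _ x 0 2 = -(4 * M / 5) * x 0
    simp only [jac, Matrix.cons_val_zero, Matrix.cons_val_two, Matrix.tail_cons, Matrix.head_cons]
    rw [hS, hS']
    ring

/-- **Strain floor in the core**: on the open core, `‖Du(x)‖ ≥ (4M/5) |x₀|` (operator norm of the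
Fréchet derivative; `|∂₀u₂| = (4M/5)|x₀|`). [folklore] -/
theorem norm_fderiv_hillField_ge (ha : 0 < a) (hab : a < b) {x : ℝ³} (hx : rsq x < a ^ 2) :
    4 * M / 5 * |x 0| ≤ ‖fderiv ℝ (hillField M a b) x‖ := by
  set L := fderiv ℝ (hillField M a b) x
  have h1 : ‖L (EuclideanSpace.single 0 (1 : ℝ))‖ ≤ ‖L‖ := by
    have h := L.le_opNorm (EuclideanSpace.single 0 (1 : ℝ))
    rwa [PiLp.norm_single, norm_one, mul_one] at h
  have h2 : |L (EuclideanSpace.single 0 (1 : ℝ)) 2| ≤ ‖L (EuclideanSpace.single 0 (1 : ℝ))‖ := by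
    have := PiLp.norm_apply_le (L (EuclideanSpace.single 0 (1 : ℝ))) 2
    simpa using this
  have h3 : L (EuclideanSpace.single 0 (1 : ℝ)) 2 = -(4 * M / 5) * x 0 := by
    simp only [L, fderiv_hillField_core_zero ha hab hx]
    simp
  rw [h3, abs_mul, abs_neg] at h2
  have h4 : |4 * M / 5| * |x 0| ≥ 4 * M / 5 * |x 0| :=
    mul_le_mul_of_nonneg_right (le_abs_self _) (abs_nonneg _)
  linarith

/-- **The dipole tail**: off the ball, `|x|² ≥ b²`, the smoothed Hill vortex is the exact
point-dipole field `u(x) = K (x₀x₂/|x|⁵, x₁x₂/|x|⁵, (2/3)/|x|³ − (x₀²+x₁²)/|x|⁵)` (Acheson (5.21):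
the irrotational flow outside the sphere). [cite: Acheson1990, §5.5, eq. (5.21)] -/
theorem hillField_of_ge (ha : 0 < a) (hab : a < b) {x : ℝ³} (hx : b ^ 2 ≤ rsq x) :
    hillField M a b x = tailConst M a b • !₂[x 0 * x 2 / ‖x‖ ^ 5, x 1 * x 2 / ‖x‖ ^ 5,
      2 / 3 / ‖x‖ ^ 3 - (x 0 ^ 2 + x 1 ^ 2) / ‖x‖ ^ 5] := by
  have hb : 0 < b := ha.trans hab
  have hs0 : 0 < rsq x := lt_of_lt_of_le (by positivity) hx
  have hS := slope_of_ge (M := M) ha.le hab hx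
  have hP := potential_of_ge (M := M) ha.le hab hx
  have hn : Real.sqrt (rsq x) = ‖x‖ := by rw [rsq_eq_norm_sq, Real.sqrt_sq (norm_nonneg _)]
  have hn0 : 0 < ‖x‖ := by rw [← hn]; exact Real.sqrt_pos.2 hs0
  have hr : rsq x = ‖x‖ ^ 2 := rsq_eq_norm_sq x
  rw [hn] at hS hP
  ext i
  fin_cases i
  · show hillField M a b x 0 = tailConst M a b * (x 0 * x 2 / ‖x‖ ^ 5)
    rw [hillField, profileField_apply_zero, hS, hr]
    field_simp
  · show hillField M a b x 1 = tailConst M a b * (x 1 * x 2 / ‖x‖ ^ 5)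
    rw [hillField, profileField_apply_one, hS, hr]
    field_simp
  · show hillField M a b x 2 = tailConst M a b * (2 / 3 / ‖x‖ ^ 3 - (x 0 ^ 2 + x 1 ^ 2) / ‖x‖ ^ 5)
    rw [hillField, profileField_apply_two, hS, hP, hr]
    field_simp
    ring

end SmoothedHill

end Summit.NavierStokesRegularity.FluidComputer

end
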